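import Literature.Computability.AlgebraicComplexity.BI17NonNormalOrbitClosuresProofs
import Literature.AlgebraicGeometry.Motives.GeneralNonsingularForms
import Literature.NumberTheory.Automorphic.ProjectiveElimination
import HarnessLib

/-!
# Almost all forms of a given degree are nonsingular (Zariski-genericity of smoothness)

Topic `Literature/Computability/AlgebraicComplexity`; theorems only (no definitions, no named
facts). Cell `val-lit` (rows X3-Poonen05 / BI2017-A); val-lit-p4 g5.

For every degree `D ≥ 1` and every number of variables `n + 2 ≥ 2`, the forms
`F ∈ ℂ[x₀,…,x_{n+1}]_D` defining a NONSINGULAR hypersurface (tree predicate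
`Literature.AlgebraicGeometry.Motives.SmoothHypersurface.IsNonsingularForm`: `F` and its partials have
no common zero `≠ 0`) form a Zariski-generic set in the sense of Bürgisser–Ikenmeyer 2017 §2.1
(tree `IsZariskiGeneric D`: they contain the non-vanishing locus of one non-zero polynomial in the
coefficients). This is the `ℂ`-instance of the FIRST clause of the typed open fact `poonen2005_thm_3`
("for a generic form, the hypersurface is smooth and `Lin X = {1}`", Poonen 2005 Thm. 3 /
Matsumura–Monsky) and the uniform version of val-lit-p5 g4's genericity step in
`BI17GenericTernaryCubicPolystable.lean` (there `(D, m) = (3, 3)`), filed once for all `(D, n)`: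

* `isZariskiGeneric_forall_exists_eval_pderiv_ne_zero` — generic forms have a non-vanishing gradient
  at every non-zero zero (the point form consumed by `isPolystable_of_forall_regular_ternaryCubic`);
* `isZariskiGeneric_isNonsingularForm` — generic forms are `IsNonsingularForm ℂ`.

Proof (no discriminant is written down): the generic form `G = Σ_d C(X_d) · x^d` over the
coefficient ring `ℂ[Sym^D ℂ^{n+2}]` specialises at `formCoeff D F` to `F`; its `n + 2` partials are
homogeneous of degree `D - 1` in `x`; by the main theorem of elimination theory on `ℂ`-points (tree
`Literature.NumberTheory.Automorphic.isClosed_setOf_exists_common_zero`, Springer 6.1.3) the set of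
coefficient vectors at which the partials have a common non-zero zero is Zariski closed; it misses
the Fermat form `Σ x_i^D` (gradient `D x_j^{D-1}`), so one of its defining polynomials `Φ` has
`Φ(Fermat) ≠ 0`, and off `{Φ = 0}` every form is nonsingular (Nullstellensatz half of the Jacobian
criterion, tree `isNonsingularForm_of_forall_exists_eval_pderiv_ne_zero`).

HONEST FRAMING: a classical genericity statement filed as literature bookkeeping; nothing here bears
on permanent versus determinant; VP ≠ VNP is NOT proved and nothing in this file is progress on it.

## References
* [Poonen2005] B. Poonen, *Varieties without extra automorphisms III: hypersurfaces*, Finite Fields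
  Appl. 11 (2005), Thm. 3 (first clause; here over `ℂ` only).
* [SpringerLAG1998] T. A. Springer, *Linear Algebraic Groups*, 2nd ed., 6.1.3 (completeness of
  projective space / elimination).
* [BurgisserIkenmeyer2017] P. Bürgisser, C. Ikenmeyer, J. Algebra 477 (2017), §2.1 ("almost all").

## Tree
`IsZariskiGeneric`, `formCoeff`, `DegIdx`, `sum_coeff_smul_monomial_eq` (BI17 / OrbitCoordinateRing);
`isClosed_setOf_exists_common_zero`, `specialize`, `isClosed_iff_exists_setOf_eval`
(NumberTheory/Automorphic); `IsNonsingularForm`, `isNonsingularForm_of_forall_exists_eval_pderiv_ne_zero`,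
`IsNonsingularForm.exists_eval_pderiv_ne_zero` (AlgebraicGeometry/Motives); pattern of
`BI2017_prop_2_10_three_three` (val-lit-p5 g4).
-/

noncomputable section

open MvPolynomial

namespace Literature.Computability.AlgebraicComplexity

open _root_.Literature.AlgebraicGeometry.Motives.SmoothHypersurface

section Generic

variable {n D : ℕ}

open Literature.NumberTheory.Automorphic in
/-- **Almost every form has non-vanishing gradient at each of its non-zero zeros** (`D ≥ 1`,
`n + 2 ≥ 2` variables, over `ℂ`): there is a non-zero polynomial `Φ` in the coefficients of
`Sym^D ℂ^{n+2}` such that every form `F` of degree `D` with `Φ(F) ≠ 0` satisfies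
`∀ z ≠ 0, F(z) = 0 → ∃ j, (∂_j F)(z) ≠ 0`. Elimination theory (Springer 6.1.3) on the partials of
the generic form, with the Fermat form as witness. [cite: Poonen2005, Thm. 3 (first clause, over ℂ)] -/
theorem isZariskiGeneric_forall_exists_eval_pderiv_ne_zero (hD : 0 < D) :
    IsZariskiGeneric D fun F : MvPolynomial (Fin (n + 2)) ℂ =>
      ∀ z : Fin (n + 2) → ℂ, z ≠ 0 → eval z F = 0 → ∃ j, eval z (pderiv j F) ≠ 0 := by
  classical
  -- the generic form of degree `D` over the coefficient ring `ℂ[Sym^D ℂ^{n+2}]`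
  set G : MvPolynomial (Fin (n + 2)) (MvPolynomial (DegIdx (Fin (n + 2)) D) ℂ) :=
    ∑ d : DegIdx (Fin (n + 2)) D, C (X d) * monomial d.1 1 with hG
  have hGhom : G.IsHomogeneous D :=
    IsHomogeneous.sum _ _ _ fun d _ =>
      (isHomogeneous_monomial (1 : MvPolynomial (DegIdx (Fin (n + 2)) D) ℂ)
        (mem_degMonomials_iff.mp d.2)).C_mul _
  -- its specialisation at the coefficient vector of a form `F` of degree `D` is `F`
  have hspec : ∀ F : MvPolynomial (Fin (n + 2)) ℂ, F.IsHomogeneous D →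
      specialize (formCoeff D F) G = F := by
    intro F hF
    rw [specialize, hG, map_sum]
    conv_rhs => rw [← sum_coeff_smul_monomial_eq hF]
    refine Finset.sum_congr rfl fun d _ => ?_
    rw [map_mul, map_C, eval_X, map_monomial, map_one, formCoeff_apply, smul_eq_C_mul]
  -- the partial derivatives, homogeneous of degree `D - 1`
  set f : Fin (n + 2) → MvPolynomial (Fin (n + 2)) (MvPolynomial (DegIdx (Fin (n + 2)) D) ℂ) :=
    fun i => pderiv i G with hf
  have hfhom : ∀ j, (f j).IsHomogeneous (D - 1) := fun j => hGhom.pderiv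
  have hfspec : ∀ F : MvPolynomial (Fin (n + 2)) ℂ, F.IsHomogeneous D → ∀ j,
      specialize (formCoeff D F) (f j) = pderiv j F := by
    intro F hF j
    rw [hf]
    dsimp only
    rw [specialize, ← pderiv_map, ← specialize, hspec F hF]
  -- the singular forms are a Zariski-closed set of coefficient vectors …
  have hS := isClosed_setOf_exists_common_zero f hfhom
  obtain ⟨T, hT⟩ := isClosed_iff_exists_setOf_eval.mp hS
  -- … missing the Fermat form
  set F₀ : MvPolynomial (Fin (n + 2)) ℂ := ∑ i : Fin (n + 2), X i ^ D with hF₀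
  have hF₀hom : F₀.IsHomogeneous D :=
    IsHomogeneous.sum _ _ _ fun i _ => isHomogeneous_X_pow i D
  have hF₀grad : ∀ (x : Fin (n + 2) → ℂ) (j : Fin (n + 2)),
      eval x (pderiv j F₀) = (D : ℂ) * x j ^ (D - 1) := by
    intro x j
    rw [hF₀, pderiv_sum_X_pow, map_mul, map_natCast, map_pow, eval_X]
  have hy₀ : formCoeff D F₀ ∉ {y : DegIdx (Fin (n + 2)) D → ℂ |
      ∃ x : Fin (n + 2) → ℂ, x ≠ 0 ∧ ∀ j, eval x (specialize y (f j)) = 0} := by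
    rintro ⟨x, hx, hzero⟩
    apply hx
    funext j
    have h := hzero j
    rw [hfspec F₀ hF₀hom, hF₀grad] at h
    have hD0 : (D : ℂ) ≠ 0 := Nat.cast_ne_zero.mpr hD.ne'
    have hpow : x j ^ (D - 1) = 0 := (mul_eq_zero.mp h).resolve_left hD0
    exact pow_eq_zero_iff'.mp hpow |>.1
  rw [hT] at hy₀
  simp only [Set.mem_setOf_eq, not_forall] at hy₀
  obtain ⟨Φ, hΦT, hΦ0⟩ := hy₀
  refine ⟨Φ, fun h => hΦ0 (by rw [h, map_zero]), fun F hF hΦF z hz hFz => ?_⟩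
  -- off `Φ = 0` the gradient does not vanish at a non-zero zero
  by_contra hgrad
  push Not at hgrad
  have hmem : formCoeff D F ∈ {y : DegIdx (Fin (n + 2)) D → ℂ |
      ∃ x : Fin (n + 2) → ℂ, x ≠ 0 ∧ ∀ j, eval x (specialize y (f j)) = 0} := by
    refine ⟨z, hz, fun j => ?_⟩
    rw [hfspec F hF]
    exact hgrad j
  rw [hT] at hmem
  have hval : eval (formCoeff D F) Φ = 0 := hmem Φ hΦT
  exact hΦF (by rw [← hval]; rfl)

/-- **Almost all forms of degree `D ≥ 1` in `n + 2 ≥ 2` variables over `ℂ` are nonsingular**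
(`IsNonsingularForm ℂ`, Hartshorne I Ex. 5.8): the `ℂ`-instance of the first clause of Poonen 2005
Thm. 3 ("for generic `F`, `X = {F = 0}` is smooth"), as a Bürgisser–Ikenmeyer `IsZariskiGeneric`
statement. From the point form by the Nullstellensatz half of the Jacobian criterion
(`isNonsingularForm_of_forall_exists_eval_pderiv_ne_zero`). [cite: Poonen2005, Thm. 3 (first clause, over ℂ)] -/
theorem isZariskiGeneric_isNonsingularForm (hD : 0 < D) :
    IsZariskiGeneric D (IsNonsingularForm ℂ : MvPolynomial (Fin (n + 2)) ℂ → Prop) :=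
  (isZariskiGeneric_forall_exists_eval_pderiv_ne_zero hD).mono fun _ _ h =>
    isNonsingularForm_of_forall_exists_eval_pderiv_ne_zero h

end Generic

end Literature.Computability.AlgebraicComplexity

end
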